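import Summits.QuantumFields.BalabanUV.T4Continuum.Support.AveragingDeficitLiftDefectSum
import Summits.QuantumFields.BalabanUV.T4Continuum.Support.AveragingDeficitBlockDensityGradSum
import HarnessLib

/-!
# AveragingDeficitGradLift (T⁴ programme, node NE3, row NE3-R2, gen 6) — (γ2), THE GRADIENT-BOUNDED ONE-STEP RIGHT INVERSE OF THE
# LINEARISED AVERAGE: `S φ := S₀φ − Q_U((pushDir∘S₀ − Id)φ)` is an EXACT right inverse of `pushDir L U` on the torus, `(L·M)`-periodic and
# `𝔲(N)`-valued for such data, with **`covGradSq U (Sφ) ([0,LM)^d) ≤ C₁(d,L)·covGradSq (cavg L U) φ ([0,M)^d) + C₂(d,L)·a²·dirSq φ ([0,M)^d)`**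
# (file 8 of (γ2) — record `t4/T4-EST-NE3-R2.md` v0.6 §4; the row's LIVE DEBT since GAPS G-ne7king10-1)

HONEST FRAMING (cell `pub-balaban`, T4-DAG PAGE 1; unit `b2b-balaban-t4-ne3r2-p1` = owner of BINDER-OWNERS row NE3-R2, gen 6).
The cell's T4 target is the finite-torus continuum limit of the unit-scale averaged loop expectations — NOT infinite volume, NO
mass gap, NOT Clay, NOT summit progress.  WHY.  In the weighted energy currency `N_k² = curlSq + L^{−2k}·dirSq` of the NE3 energy route
(GAPS G-ne7king10-1 REPAIR; `NE3CoercivityScaling` excludes the unweighted one) the residual leaf R2ᴱ must be CURL∕GRADIENT-PAIRED: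
the wall β (`DeficitDerivWall`, PROVED) pairs `‖∇_V F‖_{ℓ²}` with the dressed curl of the LIFTED direction, and `curlSq ≤ 8·covGradSq
+ 32da²·dirSq` (`AveragingDeficitCovGrad`), so the one-step lift must control the covariant GRADIENT of the lift by that of the datum.
THIS FILE delivers that lift: `gradLift φ := blockDensity L U φ − spreadInverse (liftDefect L U φ)` — the covariant block density of
file 2 corrected by leaf-01's EXACT cross-supported inverse `SpreadLift.spreadInverse` applied to the lift defect of file 6.  All
[folklore], 0 sorry: §1 `gradLift`; **`pushDir_gradLift`** (EXACT: `pushDir L U (Sφ) (L•y) κ = φ(y,κ)`, by `pushDir_add/smul` and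
`SpreadLift.pushDir_spreadInverse`); `isSkewDir_gradLift`; `isPeriodicDir_liftDefect` (translation covariance `pushDir_shift`) and
`isPeriodicDir_gradLift`; §2 **`covGradSq_gradLift_le`**: for `U` unitary of period `L·M` in `SmallField U a` with `512(d+1)(d+4)L²a ≤ 1`
and coarse data `φ` of period `M ≥ 1`,
`covGradSq U (gradLift φ) (periodBox (L·M)) ≤ kLift₁(d,L)·covGradSq (cavg L U) φ (periodBox M) + kLift₂(d,L)·a²·dirSq φ (periodBox M)`
with `kLift₁ = 4L^{d−1}/L² + 64d²L^{d−1}`, `kLift₂ = 2·kGradS0 + 64·d²·L^{d−1}·(2nbRad+1)^d·kPush²` (files 3b, 6, 7 and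
`SpreadLift.dirSq_spreadInverse_le`); §3 the plain norms `dirSq_gradLift_le`, `dirL1_gradLift_le` (the `a²`-weighted slots of the
wall).  What it is NOT: the curl-paired residual R2ᴱ_w itself (next file), ML_w, or NE3.  Nothing of
Bałaban's is asserted (context: [Balaban1985Averaging] (42) p. 23, (139)–(147) p. 39–40; [Balaban1985Variational] (75)–(77), (83) p. 289–290).
ABSOLUTE RULE kept: no printed sentence is a hypothesis.  PLACEMENT: `Summits/QuantumFields/BalabanUV/`; imports this row's
`AveragingDeficitLiftDefectSum` ∕ `AveragingDeficitBlockDensityGradSum`; moves nothing.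
-/

set_option autoImplicit false

open scoped BigOperators Matrix Matrix.Norms.L2Operator
open NormedSpace Finset

namespace Summit.QuantumFields.BalabanUV.T4Continuum.AveragingDeficitGradLift

open Literature.MathematicalPhysics.QuantumFieldTheory.Balaban1983to89
open B7Prop1Explicit B7Prop2Explicit MatrixLog UnitaryModel
open T4AveragingDeficitWall hiding Site Plane Plaq Bond
open T4AveragingDeficitWallBoundary (IsPeriodicCfg periodBox)
open T4AveragingDeficitNonAbelian (Ad_mul Ad_sub)
open AveragingDeficitTransport (norm_Ad_of_unitary mem_U1_of_unitary)
open AveragingDeficitPeriodicCounting (IsPeriodicDir)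
open AveragingDeficitResidualPairing (pushDir pushDir_mem_skewAdjoint)
open AveragingDeficitPushForwardLinear (pushDir_add pushDir_smul)
open AveragingDeficitLiftPeriodic (shiftDir pushDir_shift)
open AveragingDeficitChartCalculus (cavg)
open AveragingDeficitCovGrad (covFd covGradSq covGradSq_nonneg)
open SpreadLift (loopRad loopRad_le loopBound_of_smallField small128_of_small512 spreadInverse pushDir_spreadInverse
  isSkewDir_spreadInverse isPeriodicDir_spreadInverse dirSq_spreadInverse_le dirL1_spreadInverse_le)
open BlockAverageVaryHolo (nbRad)
open AveragingDeficitBlockDensity AveragingDeficitBlockDensityGradSum AveragingDeficitBlockDensityPush AveragingDeficitLiftDefectSum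

noncomputable section

variable {d : ℕ} {n : Type*} [Fintype n] [DecidableEq n]

section Lift

variable [Nonempty n] {L : ℕ} (hL : 1 ≤ L) {U : Site d → Fin d → (Matrix n n ℂ)ˣ} (hU : IsUnitaryCfg U) {a : ℝ} (ha : 0 ≤ a)
  (h512 : 512 * (d + 1) * (d + 4) * (L : ℝ) ^ 2 * a ≤ 1) (hUa : SmallField U a)

/-! ## §1 The lift: definition, exactness, skewness, periodicity -/

/-- **THE GRADIENT-BOUNDED LIFT (γ2)**: `S φ := S₀φ − Q_U(ψ)`, `S₀ = blockDensity`, `ψ = liftDefect = pushDir∘S₀ − Id`, `Q_U = spreadInverse`.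
[folklore] -/
def gradLift (φ : Site d → Fin d → Matrix n n ℂ) : Site d → Fin d → Matrix n n ℂ :=
  blockDensity L U φ - spreadInverse hL hU ha h512 hUa (liftDefect L U φ)

/-- `gradLift` unfolds. [folklore] -/
theorem gradLift_apply (φ : Site d → Fin d → Matrix n n ℂ) :
    gradLift hL hU ha h512 hUa φ = blockDensity L U φ - spreadInverse hL hU ha h512 hUa (liftDefect L U φ) := rfl

include hL hU ha h512 hUa in
/-- The loop variables of every coarse bond are within `1/32` of `1` under the standard smallness. [folklore] -/
theorem loopBound_small (y : Site d) (κ : Fin d) :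
    ∀ r : Fin d → Fin L, ‖((Wcx L U ((L : ℤ) • y) κ (boxVec L r) : (Matrix n n ℂ)ˣ) : Matrix n n ℂ) - 1‖ ≤ 1 / 32 :=
  fun r => (loopBound_of_smallField hL hU ha h512 hUa y κ r).trans (loopRad_le h512)

/-- **EXACT RIGHT INVERSE**: `pushDir L U (Sφ) (Ly, κ) = φ(y, κ)` for every coarse bond and every coarse datum. [folklore] -/
theorem pushDir_gradLift (φ : Site d → Fin d → Matrix n n ℂ) (y : Site d) (κ : Fin d) :
    pushDir L U (gradLift hL hU ha h512 hUa φ) ((L : ℤ) • y) κ = φ y κ := by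
  have hW := loopBound_small hL hU ha h512 hUa y κ
  rw [gradLift_apply, sub_eq_add_neg, ← neg_one_smul ℝ (spreadInverse hL hU ha h512 hUa (liftDefect L U φ)),
    pushDir_add L U _ _ _ κ hW, pushDir_smul L U (-1) _ _ κ hW, pushDir_spreadInverse, neg_one_smul]
  simp [liftDefect]

/-- `𝔲(N)` data give a `𝔲(N)` lift. [folklore] -/
theorem isSkewDir_gradLift {φ : Site d → Fin d → Matrix n n ℂ} (hφ : ∀ y κ, φ y κ ∈ skewAdjoint (Matrix n n ℂ)) :
    IsSkewDir (gradLift hL hU ha h512 hUa φ) := by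
  have hS₀ : IsSkewDir (blockDensity L U φ) := isSkewDir_blockDensity hU L hφ
  have hψ : ∀ y κ, liftDefect L U φ y κ ∈ skewAdjoint (Matrix n n ℂ) := fun y κ =>
    (skewAdjoint _).sub_mem (pushDir_mem_skewAdjoint L hU hS₀ _ κ fun r =>
      lt_of_le_of_lt (loopBound_small hL hU ha h512 hUa y κ r) (by norm_num)) (hφ y κ)
  intro x μ
  rw [gradLift_apply, Pi.sub_apply, Pi.sub_apply]
  exact (skewAdjoint _).sub_mem (hS₀ x μ) (isSkewDir_spreadInverse hL hU ha h512 hUa hψ x μ)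

include hL in
omit [Nonempty n] in
/-- **THE LIFT DEFECT IS `M`-PERIODIC** for `U` of period `L·M` and `φ` of period `M` (translation covariance of (42)). [folklore] -/
theorem isPeriodicDir_liftDefect {M : ℕ} (hUP : IsPeriodicCfg U ((L : ℤ) * M)) {φ : Site d → Fin d → Matrix n n ℂ}
    (hφ : IsPeriodicDir φ (M : ℤ)) : IsPeriodicDir (liftDefect L U φ) (M : ℤ) := by
  intro y j κ
  have hS₀P := isPeriodicDir_blockDensity hL hUP hφ
  have hUv : ∀ (x : Site d) (μ : Fin d), U (x + ((L : ℤ) * M) • e j) μ = U x μ := fun x μ => hUP x j μ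
  have hshift : shiftDir (((L : ℤ) * M) • e j) (blockDensity L U φ) = blockDensity L U φ := by
    funext z i
    have h := hS₀P (z - ((L : ℤ) * M) • e j) j i
    rw [sub_add_cancel] at h
    rw [shiftDir, ← h]
  have h := pushDir_shift L hUv (blockDensity L U φ) ((L : ℤ) • y) κ
  rw [hshift, show (L : ℤ) • y + ((L : ℤ) * M) • e j = (L : ℤ) • (y + (M : ℤ) • e j) by rw [smul_add, smul_smul]] at h
  simp only [liftDefect, h, hφ y j κ]

include hL in
/-- **THE LIFT IS `(L·M)`-PERIODIC** for `U` of period `L·M` and `φ` of period `M`. [folklore] -/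
theorem isPeriodicDir_gradLift {M : ℕ} (hUP : IsPeriodicCfg U ((L : ℤ) * M)) {φ : Site d → Fin d → Matrix n n ℂ}
    (hφ : IsPeriodicDir φ (M : ℤ)) : IsPeriodicDir (gradLift hL hU ha h512 hUa φ) ((L : ℤ) * M) := by
  have h1 := isPeriodicDir_blockDensity hL hUP hφ
  have hψ := isPeriodicDir_liftDefect hL hUP hφ
  have h2 := isPeriodicDir_spreadInverse hL hU ha h512 hUa hUP (φ := liftDefect L U φ) fun y j κ => hψ y j κ
  intro x j μ
  simp only [gradLift_apply, Pi.sub_apply]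
  rw [h1 x j μ, h2 x j μ]

/-! ## §2 The gradient bound -/

/-- THE CONSTANT of the coarse covariant gradient: `4L^{d−1}/L² + 64·d²·L^{d−1}`. [folklore] -/
def kLift₁ (d L : ℕ) : ℝ := 4 * (L : ℝ) ^ (d - 1) / (L : ℝ) ^ 2 + 64 * (d : ℝ) ^ 2 * (L : ℝ) ^ (d - 1)

/-- THE CONSTANT of the `a²·dirSq` term: `2·kGradS0 + 64·d²·L^{d−1}·(2·nbRad+1)^d·kPush²`. [folklore] -/
def kLift₂ (d L : ℕ) : ℝ :=
  2 * kGradS0 d L + 64 * (d : ℝ) ^ 2 * (L : ℝ) ^ (d - 1) * (2 * nbRad d L + 1) ^ d * kPush d L ^ 2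

omit [Nonempty n] in
/-- The covariant gradient of a difference: `covGradSq V (A − B) ≤ 2·covGradSq V A + 2·covGradSq V B`. [folklore] -/
theorem covGradSq_sub_le (A B : Site d → Fin d → Matrix n n ℂ) (F : Finset (Site d)) :
    covGradSq U (A - B) F ≤ 2 * covGradSq U A F + 2 * covGradSq U B F := by
  unfold covGradSq
  rw [Finset.mul_sum, Finset.mul_sum, ← Finset.sum_add_distrib]
  refine Finset.sum_le_sum fun x _ => ?_
  rw [Finset.mul_sum, Finset.mul_sum, ← Finset.sum_add_distrib]
  refine Finset.sum_le_sum fun μ _ => ?_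
  rw [Finset.mul_sum, Finset.mul_sum, ← Finset.sum_add_distrib]
  refine Finset.sum_le_sum fun ν _ => ?_
  have e1 : covFd U (A - B) x μ ν = covFd U A x μ ν - covFd U B x μ ν := by
    simp only [covFd, Pi.sub_apply, Ad_sub]; abel
  rw [e1]
  have h := norm_sub_le (covFd U A x μ ν) (covFd U B x μ ν)
  have h0 : 0 ≤ ‖covFd U A x μ ν - covFd U B x μ ν‖ := norm_nonneg _
  nlinarith [sq_nonneg (‖covFd U A x μ ν‖ - ‖covFd U B x μ ν‖), norm_nonneg (covFd U A x μ ν), norm_nonneg (covFd U B x μ ν)]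

include hL hU ha h512 hUa in
/-- **(γ2) THE GRADIENT BOUND OF THE LIFT ON THE TORUS**: for `U` unitary of period `L·M` in `SmallField U a` with
`512(d+1)(d+4)L²a ≤ 1` and coarse data `φ` of period `M ≥ 1`,
`covGradSq U (Sφ) ([0,LM)^d) ≤ kLift₁(d,L)·covGradSq (cavg L U) φ ([0,M)^d) + kLift₂(d,L)·a²·dirSq φ ([0,M)^d)`. [folklore] -/
theorem covGradSq_gradLift_le {M : ℕ} (hM : 1 ≤ M) (hUP : IsPeriodicCfg U ((L : ℤ) * M)) {φ : Site d → Fin d → Matrix n n ℂ}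
    (hφ : IsPeriodicDir φ (M : ℤ)) :
    covGradSq U (gradLift hL hU ha h512 hUa φ) (periodBox (L * M))
      ≤ kLift₁ d L * covGradSq (cavg L U) φ (periodBox M) + kLift₂ d L * a ^ 2 * dirSq φ (periodBox M) := by
  have hLM : 1 ≤ L * M := Nat.one_le_iff_ne_zero.mpr (Nat.mul_ne_zero (by omega) (by omega))
  set ψ := liftDefect L U φ with hψ
  set Ψ := spreadInverse hL hU ha h512 hUa ψ with hΨ
  -- (1) split the difference
  have h0 := covGradSq_sub_le (U := U) (blockDensity L U φ) Ψ (periodBox (L * M))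
  -- (2) the block density (file 3b)
  have h1 := covGradSq_blockDensity_le hL hU ha h512 hUa hM hφ
  -- (3) the correction: gradient ≤ 4d·dirSq ≤ 4d·4·L^{d−1}·dirSq ψ
  have hψP : IsPeriodicDir ψ (M : ℤ) := isPeriodicDir_liftDefect hL hUP hφ
  have hΨP : IsPeriodicDir Ψ ((L : ℤ) * M) := isPeriodicDir_spreadInverse hL hU ha h512 hUa hUP (φ := ψ) fun y j κ => hψP y j κ
  have hΨP' : IsPeriodicDir Ψ ((L * M : ℕ) : ℤ) := by rw [AveragingDeficitPeriodicCounting.natCast_mul_period]; exact hΨP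
  have h2 := covGradSq_le_dirSq hLM hU hΨP'
  have h3 := dirSq_spreadInverse_le hL hU ha h512 hUa ψ M
  have h128 := small128_of_small512 (d := d) ha h512
  have hfac : (1 + 128 * (d * (L : ℝ) ^ 2 * a)) ^ 2 ≤ 4 := by
    have hx0 : 0 ≤ 128 * (d * (L : ℝ) ^ 2 * a) := by positivity
    have h2' : 1 + 128 * (d * (L : ℝ) ^ 2 * a) ≤ 2 := by linarith
    calc (1 + 128 * (d * (L : ℝ) ^ 2 * a)) ^ 2 ≤ (2 : ℝ) ^ 2 := pow_le_pow_left₀ (by linarith) h2' 2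
      _ = 4 := by norm_num
  have hdirψ : ∑ y ∈ periodBox M, ∑ i : Fin d, ‖ψ y i‖ ^ 2 = dirSq ψ (periodBox M) := rfl
  rw [hdirψ] at h3
  -- (4) the lift defect over the period (file 7)
  have h4 := dirSq_liftDefect_le hL hU ha h512 hUa hM hφ
  rw [← hψ] at h4
  -- nonnegativity bookkeeping
  have hcg0 : 0 ≤ covGradSq (cavg L U) φ (periodBox M) := covGradSq_nonneg _ _ _
  have hds0 : 0 ≤ dirSq φ (periodBox M) := Finset.sum_nonneg fun _ _ => Finset.sum_nonneg fun _ _ => sq_nonneg _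
  have hdψ0 : 0 ≤ dirSq ψ (periodBox M) := Finset.sum_nonneg fun _ _ => Finset.sum_nonneg fun _ _ => sq_nonneg _
  have hLd0 : 0 ≤ (L : ℝ) ^ (d - 1) := by positivity
  have hk0 : 0 ≤ (kPush d L * a) ^ 2 := sq_nonneg _
  have hR0 : (0 : ℝ) ≤ (2 * nbRad d L + 1) ^ d := by positivity
  -- chain
  have hΨ' : dirSq Ψ (periodBox (L * M)) ≤ 4 * (L : ℝ) ^ (d - 1) * dirSq ψ (periodBox M) :=
    h3.trans (mul_le_mul_of_nonneg_right (mul_le_mul_of_nonneg_right hfac hLd0) hdψ0)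
  have hcorr : covGradSq U Ψ (periodBox (L * M))
      ≤ 16 * d * (L : ℝ) ^ (d - 1) * (2 * d * covGradSq (cavg L U) φ (periodBox M)
          + 2 * d * (2 * nbRad d L + 1) ^ d * (kPush d L * a) ^ 2 * dirSq φ (periodBox M)) := by
    have hd0 : (0 : ℝ) ≤ 4 * d := by positivity
    calc covGradSq U Ψ (periodBox (L * M)) ≤ 4 * d * dirSq Ψ (periodBox (L * M)) := h2
      _ ≤ 4 * d * (4 * (L : ℝ) ^ (d - 1) * dirSq ψ (periodBox M)) := mul_le_mul_of_nonneg_left hΨ' hd0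
      _ ≤ 4 * d * (4 * (L : ℝ) ^ (d - 1) * (2 * d * covGradSq (cavg L U) φ (periodBox M)
          + 2 * d * (2 * nbRad d L + 1) ^ d * (kPush d L * a) ^ 2 * dirSq φ (periodBox M))) := by
          gcongr
      _ = _ := by ring
  calc covGradSq U (gradLift hL hU ha h512 hUa φ) (periodBox (L * M))
      ≤ 2 * covGradSq U (blockDensity L U φ) (periodBox (L * M)) + 2 * covGradSq U Ψ (periodBox (L * M)) := h0
    _ ≤ 2 * (2 * (L : ℝ) ^ (d - 1) / (L : ℝ) ^ 2 * covGradSq (cavg L U) φ (periodBox M) + kGradS0 d L * a ^ 2 * dirSq φ (periodBox M))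
        + 2 * (16 * d * (L : ℝ) ^ (d - 1) * (2 * d * covGradSq (cavg L U) φ (periodBox M)
          + 2 * d * (2 * nbRad d L + 1) ^ d * (kPush d L * a) ^ 2 * dirSq φ (periodBox M))) := by gcongr
    _ = kLift₁ d L * covGradSq (cavg L U) φ (periodBox M) + kLift₂ d L * a ^ 2 * dirSq φ (periodBox M) := by
        rw [kLift₁, kLift₂]; ring

/-! ## §3 The plain norms of the lift -/

omit [Nonempty n] in
/-- `dirSq (A − B) ≤ 2·dirSq A + 2·dirSq B`. [folklore] -/
theorem dirSq_sub_le (A B : Site d → Fin d → Matrix n n ℂ) (F : Finset (Site d)) :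
    dirSq (A - B) F ≤ 2 * dirSq A F + 2 * dirSq B F := by
  unfold dirSq
  rw [Finset.mul_sum, Finset.mul_sum, ← Finset.sum_add_distrib]
  refine Finset.sum_le_sum fun x _ => ?_
  rw [Finset.mul_sum, Finset.mul_sum, ← Finset.sum_add_distrib]
  refine Finset.sum_le_sum fun μ _ => ?_
  rw [Pi.sub_apply, Pi.sub_apply]
  have h := norm_sub_le (A x μ) (B x μ)
  have h0 : 0 ≤ ‖A x μ - B x μ‖ := norm_nonneg _
  nlinarith [sq_nonneg (‖A x μ‖ - ‖B x μ‖), norm_nonneg (A x μ), norm_nonneg (B x μ)]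

omit [Nonempty n] in
/-- `dirL1 (A − B) ≤ dirL1 A + dirL1 B`. [folklore] -/
theorem dirL1_sub_le (A B : Site d → Fin d → Matrix n n ℂ) (F : Finset (Site d)) :
    dirL1 (A - B) F ≤ dirL1 A F + dirL1 B F := by
  unfold dirL1
  rw [← Finset.sum_add_distrib]
  refine Finset.sum_le_sum fun x _ => ?_
  rw [← Finset.sum_add_distrib]
  exact Finset.sum_le_sum fun μ _ => by rw [Pi.sub_apply, Pi.sub_apply]; exact norm_sub_le _ _

include hL hU ha h512 hUa in
/-- **THE `ℓ²` NORM OF THE LIFT**: `dirSq (Sφ) ([0,LM)^d) ≤ (2L^d/L² + 16dL^{d−1}(2nbRad+1)^d·kPush²·a²)·dirSq φ + 16dL^{d−1}·covGradSq (cavg L U) φ`.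
[folklore] -/
theorem dirSq_gradLift_le {M : ℕ} (hM : 1 ≤ M) (hUP : IsPeriodicCfg U ((L : ℤ) * M)) {φ : Site d → Fin d → Matrix n n ℂ}
    (hφ : IsPeriodicDir φ (M : ℤ)) :
    dirSq (gradLift hL hU ha h512 hUa φ) (periodBox (L * M))
      ≤ 16 * d * (L : ℝ) ^ (d - 1) * covGradSq (cavg L U) φ (periodBox M)
        + (2 * ((L : ℝ) ^ d / (L : ℝ) ^ 2) + 16 * d * (L : ℝ) ^ (d - 1) * (2 * nbRad d L + 1) ^ d * (kPush d L * a) ^ 2)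
          * dirSq φ (periodBox M) := by
  have _ := hUP
  set ψ := liftDefect L U φ with hψ
  have h0 := dirSq_sub_le (blockDensity L U φ) (spreadInverse hL hU ha h512 hUa ψ) (periodBox (L * M))
  have h1 := dirSq_blockDensity hU hL φ M
  have h3 := dirSq_spreadInverse_le hL hU ha h512 hUa ψ M
  have h128 := small128_of_small512 (d := d) ha h512
  have hfac : (1 + 128 * (d * (L : ℝ) ^ 2 * a)) ^ 2 ≤ 4 := by
    have hx0 : 0 ≤ 128 * (d * (L : ℝ) ^ 2 * a) := by positivity
    have h2' : 1 + 128 * (d * (L : ℝ) ^ 2 * a) ≤ 2 := by linarith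
    calc (1 + 128 * (d * (L : ℝ) ^ 2 * a)) ^ 2 ≤ (2 : ℝ) ^ 2 := pow_le_pow_left₀ (by linarith) h2' 2
      _ = 4 := by norm_num
  have hdirψ : ∑ y ∈ periodBox M, ∑ i : Fin d, ‖ψ y i‖ ^ 2 = dirSq ψ (periodBox M) := rfl
  rw [hdirψ] at h3
  have h4 := dirSq_liftDefect_le hL hU ha h512 hUa hM hφ
  rw [← hψ] at h4
  have hdψ0 : 0 ≤ dirSq ψ (periodBox M) := Finset.sum_nonneg fun _ _ => Finset.sum_nonneg fun _ _ => sq_nonneg _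
  have hLd0 : 0 ≤ (L : ℝ) ^ (d - 1) := by positivity
  have hΨ' : dirSq (spreadInverse hL hU ha h512 hUa ψ) (periodBox (L * M)) ≤ 4 * (L : ℝ) ^ (d - 1) * dirSq ψ (periodBox M) :=
    h3.trans (mul_le_mul_of_nonneg_right (mul_le_mul_of_nonneg_right hfac hLd0) hdψ0)
  have hΨ'' : dirSq (spreadInverse hL hU ha h512 hUa ψ) (periodBox (L * M))
      ≤ 4 * (L : ℝ) ^ (d - 1) * (2 * d * covGradSq (cavg L U) φ (periodBox M)
          + 2 * d * (2 * nbRad d L + 1) ^ d * (kPush d L * a) ^ 2 * dirSq φ (periodBox M)) :=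
    hΨ'.trans (mul_le_mul_of_nonneg_left h4 (by positivity))
  rw [gradLift_apply]
  calc _ ≤ 2 * dirSq (blockDensity L U φ) (periodBox (L * M)) + 2 * dirSq (spreadInverse hL hU ha h512 hUa ψ) (periodBox (L * M)) := h0
    _ ≤ 2 * ((L : ℝ) ^ d / (L : ℝ) ^ 2 * dirSq φ (periodBox M))
        + 2 * (4 * (L : ℝ) ^ (d - 1) * (2 * d * covGradSq (cavg L U) φ (periodBox M)
          + 2 * d * (2 * nbRad d L + 1) ^ d * (kPush d L * a) ^ 2 * dirSq φ (periodBox M))) := by rw [h1]; gcongr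
    _ = _ := by ring

include hL hU ha h512 hUa in
/-- **THE `ℓ¹` NORM OF THE LIFT**: `dirL1 (Sφ) ([0,LM)^d) ≤ 2L^{d−1}·covGradL1 (cavg L U) φ + (L^d/L + 2dL^{d−1}(2nbRad+1)^d·kPush·a)·dirL1 φ`.
[folklore] -/
theorem dirL1_gradLift_le {M : ℕ} (hM : 1 ≤ M) (hUP : IsPeriodicCfg U ((L : ℤ) * M)) {φ : Site d → Fin d → Matrix n n ℂ}
    (hφ : IsPeriodicDir φ (M : ℤ)) :
    dirL1 (gradLift hL hU ha h512 hUa φ) (periodBox (L * M))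
      ≤ 2 * (L : ℝ) ^ (d - 1) * covGradL1 (cavg L U) φ (periodBox M)
        + ((L : ℝ) ^ d / L + 2 * (L : ℝ) ^ (d - 1) * (d * (2 * nbRad d L + 1) ^ d * (kPush d L * a))) * dirL1 φ (periodBox M) := by
  have _ := hUP
  set ψ := liftDefect L U φ with hψ
  have h0 := dirL1_sub_le (blockDensity L U φ) (spreadInverse hL hU ha h512 hUa ψ) (periodBox (L * M))
  have h1 := dirL1_blockDensity hU hL φ M
  have h3 := dirL1_spreadInverse_le hL hU ha h512 hUa ψ M
  have h128 := small128_of_small512 (d := d) ha h512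
  have hfac : 1 + 128 * (d * (L : ℝ) ^ 2 * a) ≤ 2 := by linarith
  have hdirψ : ∑ y ∈ periodBox M, ∑ i : Fin d, ‖ψ y i‖ = dirL1 ψ (periodBox M) := rfl
  rw [hdirψ] at h3
  have h4 := dirL1_liftDefect_le hL hU ha h512 hUa hM hφ
  rw [← hψ] at h4
  have hdψ0 : 0 ≤ dirL1 ψ (periodBox M) := Finset.sum_nonneg fun _ _ => Finset.sum_nonneg fun _ _ => norm_nonneg _
  have hLd0 : 0 ≤ (L : ℝ) ^ (d - 1) := by positivity
  have hΨ' : dirL1 (spreadInverse hL hU ha h512 hUa ψ) (periodBox (L * M)) ≤ 2 * (L : ℝ) ^ (d - 1) * dirL1 ψ (periodBox M) :=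
    h3.trans (mul_le_mul_of_nonneg_right (mul_le_mul_of_nonneg_right hfac hLd0) hdψ0)
  have hΨ'' : dirL1 (spreadInverse hL hU ha h512 hUa ψ) (periodBox (L * M))
      ≤ 2 * (L : ℝ) ^ (d - 1) * (covGradL1 (cavg L U) φ (periodBox M)
          + d * (2 * nbRad d L + 1) ^ d * (kPush d L * a) * dirL1 φ (periodBox M)) :=
    hΨ'.trans (mul_le_mul_of_nonneg_left h4 (by positivity))
  rw [gradLift_apply]
  calc _ ≤ dirL1 (blockDensity L U φ) (periodBox (L * M)) + dirL1 (spreadInverse hL hU ha h512 hUa ψ) (periodBox (L * M)) := h0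
    _ ≤ (L : ℝ) ^ d / (L : ℝ) * dirL1 φ (periodBox M)
        + 2 * (L : ℝ) ^ (d - 1) * (covGradL1 (cavg L U) φ (periodBox M)
          + d * (2 * nbRad d L + 1) ^ d * (kPush d L * a) * dirL1 φ (periodBox M)) := by rw [h1]; gcongr
    _ = _ := by ring

end Lift

end

end Summit.QuantumFields.BalabanUV.T4Continuum.AveragingDeficitGradLift
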